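import Summits.QuantumAdvantage.QuantumAdvantage.Theorems.OrbitAveragingB

/-! # OrbitAveragingC — part 3/5 (mechanical split for landing of `OrbitAveraging`; content verbatim; scopes re-opened with their variables) -/

set_option linter.dupNamespace false
set_option linter.style.longLine false
set_option linter.unusedVariables false
noncomputable section
open scoped Classical

namespace Summit.QuantumAdvantage.QuantumAdvantage.Theorems.OrbitAveraging
open Finset
open Literature.Computability.QuantumComplexity Literature.Computability.QuantumComplexity.RingHLF
open Literature.Computability.MetaComplexity Literature.Computability.MetaComplexity.Smolensky
open Summit.QuantumAdvantage.AdviceFreeQNC0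
open Summit.QuantumAdvantage.QuantumAdvantage.Theorems (flat)
open Summit.QuantumAdvantage.QuantumAdvantage.Theorems.RingPeriodFold (cov covStrat covStrat_mem_lowDeg cov_eq_covStrat)
open Summit.QuantumAdvantage.QuantumAdvantage.Theorems.SpreadBridge (JointStrategy winAllSet sum_card_filter_update
  fibre_decrement decay_le_half)
variable {n : ℕ}

/-- **the equivariant bridge at one degree exponent**: invariant-foreign spread for uniform victims at lengths `≥ n₀`
(parameters `η ∈ (0,1]`, `k`, degree `δ n`) gives, at every `n ≥ max n₀ 1`, `#winAll ≤ (1 - η/2)·2^(n^k·n)` for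
EQUIVARIANT joint strategies of degree `≤ δ n` on `n^k` rings. -/
theorem card_winAllSet_le_of_invSpread {η : ℝ} (hη : 0 < η) (hη1 : η ≤ 1) {k : ℕ} {δ : ℕ → ℕ} {n₀ : ℕ}
    (hS : ∀ n ≥ n₀, ∀ Q₀ : CubeFn (ZMod 3) n, Q₀ ∈ lowDeg (ZMod 3) n (δ n) →
      ∀ t : ℕ, t ≤ n ^ k → ∀ w : Fin t → Fin n → Bool, ∀ F : Fin t → Fin n → CubeFn (ZMod 3) n,
        (∀ s i, F s i ∈ lowDeg (ZMod 3) n (δ n)) →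
        (∀ s i y, decide (F s i (rot 1 y) = 1) = decide (F s i y = 1)) →
        (1 - η) * (2 : ℝ) ^ n ≤ ((univ.filter fun y : Fin n → Bool =>
            ∀ s, RingHLF.Rel (w s) (fun i => decide (F s i y = 1))).card : ℝ) →
        1 / (n : ℝ) ^ k * (2 : ℝ) ^ n ≤ ((univ.filter fun y : Fin n → Bool =>
            (∀ s, RingHLF.Rel (w s) (fun i => decide (F s i y = 1))) ∧
              ¬ RingHLF.Rel y (cov Q₀ y)).card : ℝ))
    {n : ℕ} (hn : max n₀ 1 ≤ n) (P : JointStrategy (n ^ k) n)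
    (hEqv : ((∀ (X : Fin (n ^ k) → Fin n → Bool) (j : Fin (n ^ k)) (y : Fin n → Bool) (r : ℕ) (i : Fin n),
      decide (P j i (flat (Function.update X j (rot r y))) = 1) =
        decide (P j (RingSymmetry.shift n r i) (flat (Function.update X j y)) = 1)) ∧
    (∀ (X : Fin (n ^ k) → Fin n → Bool) (j s : Fin (n ^ k)), s ≠ j → ∀ (y : Fin n → Bool) (i : Fin n),
      decide (P s i (flat (Function.update X j (rot 1 y))) = 1) =
        decide (P s i (flat (Function.update X j y)) = 1))))
    (hP : ∀ j i, P j i ∈ lowDeg (ZMod 3) (n ^ k * n) (δ n)) :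
    ((winAllSet P).card : ℝ) ≤ (1 - η / 2) * (2 : ℝ) ^ (n ^ k * n) := by
  have hnn₀ : n₀ ≤ n := le_of_max_le_left hn
  have hn1 : 1 ≤ n := le_of_max_le_right hn
  have hn1r : (1 : ℝ) ≤ n := by exact_mod_cast hn1
  have hd0 : (0 : ℝ) ≤ 1 / (n : ℝ) ^ k := by positivity
  have hd1 : 1 / (n : ℝ) ^ k ≤ 1 := by
    rw [div_le_one (by positivity)]; exact one_le_pow₀ hn1r
  have hyb := card_winAllSet_le_hybrid_eqv (by omega) hη1 hd0 hd1 P hEqv.1 hEqv.2 hP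
    (fun Q₀ hQ₀ t ht w F hF hFinv => hS n hnn₀ Q₀ hQ₀ t ht.le w F hF hFinv)
  refine le_trans hyb (mul_le_mul_of_nonneg_right ?_ (by positivity))
  have hq := decay_le_half (k := k) hn1
  nlinarith [mul_le_mul_of_nonneg_left hq hη.le]

/-- **`HybridEqv3` PROVED**: `(∃ η : ℝ, 0 < η ∧ ∃ k : ℕ, ∀ c : ℕ, ∃ n₀ : ℕ, ∀ n ≥ n₀, ∀ Q : CubeFn (ZMod 3) n,
  Q ∈ lowDeg (ZMod 3) n ((Nat.log 2 n) ^ c) →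
  ∀ m : ℕ, m ≤ n ^ k → ∀ w : Fin m → Fin n → Bool, ∀ F : Fin m → Fin n → CubeFn (ZMod 3) n,
    (∀ t i, F t i ∈ lowDeg (ZMod 3) n ((Nat.log 2 n) ^ c)) →
    (∀ t i y, decide (F t i (rot 1 y) = 1) = decide (F t i y = 1)) →
    (1 - η) * (2 : ℝ) ^ n ≤ ((univ.filter fun y : Fin n → Bool =>
        ∀ t, RingHLF.Rel (w t) (fun i => decide (F t i y = 1))).card : ℝ) →
    1 / (n : ℝ) ^ k * (2 : ℝ) ^ n ≤ ((univ.filter fun y : Fin n → Bool =>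
        (∀ t, RingHLF.Rel (w t) (fun i => decide (F t i y = 1))) ∧ ¬ RingHLF.Rel y (cov Q y)).card : ℝ)) → (∃ K : ℕ, ∃ θ : ℝ, θ < 1 ∧ ∀ c : ℕ, ∃ n₀ : ℕ, ∀ n ≥ n₀,
  ∀ P : Fin (n ^ K) → Fin n → CubeFn (ZMod 3) (n ^ K * n), ((∀ (X : Fin (n ^ K) → Fin n → Bool) (j : Fin (n ^ K)) (y : Fin n → Bool) (r : ℕ) (i : Fin n),
      decide (P j i (flat (Function.update X j (rot r y))) = 1) =
        decide (P j (RingSymmetry.shift n r i) (flat (Function.update X j y)) = 1)) ∧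
    (∀ (X : Fin (n ^ K) → Fin n → Bool) (j s : Fin (n ^ K)), s ≠ j → ∀ (y : Fin n → Bool) (i : Fin n),
      decide (P s i (flat (Function.update X j (rot 1 y))) = 1) =
        decide (P s i (flat (Function.update X j y)) = 1))) →
    (∀ j i, P j i ∈ lowDeg (ZMod 3) (n ^ K * n) ((Nat.log 2 n) ^ c)) →
    ((univ.filter fun X : Fin (n ^ K) → Fin n → Bool => ∀ j, RingHLF.Rel (X j)
      (fun i => decide (P j i (fun k => X (finProdFinEquiv.symm k).1 (finProdFinEquiv.symm k).2) = 1))).card : ℝ)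
      ≤ θ * (2 : ℝ) ^ (n ^ K * n))` (`K := k`, `θ := 1 - min η 1 / 2`). -/
theorem hybridEqv3 :
    (∃ η : ℝ, 0 < η ∧ ∃ k : ℕ, ∀ c : ℕ, ∃ n₀ : ℕ, ∀ n ≥ n₀, ∀ Q : CubeFn (ZMod 3) n,
  Q ∈ lowDeg (ZMod 3) n ((Nat.log 2 n) ^ c) →
  ∀ m : ℕ, m ≤ n ^ k → ∀ w : Fin m → Fin n → Bool, ∀ F : Fin m → Fin n → CubeFn (ZMod 3) n,
    (∀ t i, F t i ∈ lowDeg (ZMod 3) n ((Nat.log 2 n) ^ c)) →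
    (∀ t i y, decide (F t i (rot 1 y) = 1) = decide (F t i y = 1)) →
    (1 - η) * (2 : ℝ) ^ n ≤ ((univ.filter fun y : Fin n → Bool =>
        ∀ t, RingHLF.Rel (w t) (fun i => decide (F t i y = 1))).card : ℝ) →
    1 / (n : ℝ) ^ k * (2 : ℝ) ^ n ≤ ((univ.filter fun y : Fin n → Bool =>
        (∀ t, RingHLF.Rel (w t) (fun i => decide (F t i y = 1))) ∧ ¬ RingHLF.Rel y (cov Q y)).card : ℝ)) →
    (∃ K : ℕ, ∃ θ : ℝ, θ < 1 ∧ ∀ c : ℕ, ∃ n₀ : ℕ, ∀ n ≥ n₀,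
  ∀ P : Fin (n ^ K) → Fin n → CubeFn (ZMod 3) (n ^ K * n), ((∀ (X : Fin (n ^ K) → Fin n → Bool) (j : Fin (n ^ K)) (y : Fin n → Bool) (r : ℕ) (i : Fin n),
      decide (P j i (flat (Function.update X j (rot r y))) = 1) =
        decide (P j (RingSymmetry.shift n r i) (flat (Function.update X j y)) = 1)) ∧
    (∀ (X : Fin (n ^ K) → Fin n → Bool) (j s : Fin (n ^ K)), s ≠ j → ∀ (y : Fin n → Bool) (i : Fin n),
      decide (P s i (flat (Function.update X j (rot 1 y))) = 1) =
        decide (P s i (flat (Function.update X j y)) = 1))) →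
    (∀ j i, P j i ∈ lowDeg (ZMod 3) (n ^ K * n) ((Nat.log 2 n) ^ c)) →
    ((univ.filter fun X : Fin (n ^ K) → Fin n → Bool => ∀ j, RingHLF.Rel (X j)
      (fun i => decide (P j i (fun k => X (finProdFinEquiv.symm k).1 (finProdFinEquiv.symm k).2) = 1))).card : ℝ)
      ≤ θ * (2 : ℝ) ^ (n ^ K * n)) := by
  rintro ⟨η, hη, k, hk⟩
  have hη' : 0 < min η 1 := lt_min hη one_pos
  refine ⟨k, 1 - min η 1 / 2, by linarith, fun c => ?_⟩
  obtain ⟨n₀, hn₀⟩ := hk c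
  refine ⟨max n₀ 1, fun n hn P hEqv hP => ?_⟩
  have h := card_winAllSet_le_of_invSpread (δ := fun n => (Nat.log 2 n) ^ c) (k := k) (n₀ := n₀)
    hη' (min_le_right η 1) (fun n hn Q₀ hQ₀ t ht w F hF hFinv hdens => hn₀ n hn Q₀ hQ₀ t ht w F hF hFinv
      (le_trans (mul_le_mul_of_nonneg_right (by linarith [min_le_left η 1]) (by positivity)) hdens)) hn P hEqv hP
  exact h

/-! ## §6 The `m = 1` normal form at CONSTANT grade (PROVED): `RingHardOdd 3 ↔ (∃ θ : ℝ, θ < 1 ∧ ∀ c : ℕ, ∃ n₀ : ℕ, ∀ n ≥ n₀, ∀ Q : CubeFn (ZMod 3) n,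
  Q ∈ lowDeg (ZMod 3) n ((Nat.log 2 n) ^ c) →
    ((univ.filter fun x : Fin n → Bool => OddZeros x ∧ RingHLF.Rel x (cov Q x)).card : ℝ) ≤ θ * (2 : ℝ) ^ (n - 1))` -/

/-- **THE CONSTANT-GRADE SYMMETRISATION LAW, hard direction**: constant loss of every uniform polylog-degree rule on
the odd class ⟹ `RingHardOdd 3` (`θ ↦ (1+θ)/2`, degree exponent `c ↦ max c 4 + 1`): elect a leader with the
landed `𝔽₃` election (`RingLeaderElection3.exists_election3`, divisor `M = n`, parameters `election_params 0 n`),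
symmetrise with the landed PHASE-AVERAGED `symmetrization3`, absorb the bad set `2ⁿ/n²`. This is the `m = 1`
instance of piece W at the grade of T. -/
theorem ringHardOdd3_of_cov (h : (∃ θ : ℝ, θ < 1 ∧ ∀ c : ℕ, ∃ n₀ : ℕ, ∀ n ≥ n₀, ∀ Q : CubeFn (ZMod 3) n,
  Q ∈ lowDeg (ZMod 3) n ((Nat.log 2 n) ^ c) →
    ((univ.filter fun x : Fin n → Bool => OddZeros x ∧ RingHLF.Rel x (cov Q x)).card : ℝ) ≤ θ * (2 : ℝ) ^ (n - 1))) : RingHardOdd 3 := by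
  obtain ⟨θ, hθ, hC⟩ := h
  refine ⟨(1 + θ) / 2, by linarith, fun c => ?_⟩
  obtain ⟨n₁, hn₁⟩ := hC (max c 4 + 1)
  refine ⟨max n₁ (max (2 ^ 11) ⌈4 / (1 - θ)⌉₊), fun n hn P hP => ?_⟩
  have hn₁' : n₁ ≤ n := le_trans (le_max_left _ _) hn
  have h11 : 2 ^ 11 ≤ n := le_trans (le_max_left _ _) (le_trans (le_max_right _ _) hn)
  have hceil : ⌈4 / (1 - θ)⌉₊ ≤ n := le_trans (le_max_right _ _) (le_trans (le_max_right _ _) hn)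
  have hnC : 2 ^ (2 * 0 + 11) ≤ n := by norm_num at h11 ⊢; exact h11
  have hn2 : 2 ≤ n := le_trans (by norm_num) h11
  have hn0 : 0 < n := by omega
  obtain ⟨h2l, ht, hl, hdeg⟩ := Theorems.RingSymmetrization3.election_params 0 n hnC
  set L := Nat.log 2 n with hL
  obtain ⟨e, he, he01, hbad⟩ := Theorems.RingLeaderElection3.exists_election3 hn0 h2l ht hl
  have hL2 : 2 ≤ L := Nat.le_log_of_pow_le (by norm_num) (show 2 ^ 2 ≤ n from le_trans (by norm_num) h11)
  -- degree bookkeeping: `L^c + 4tℓ ≤ L^c + L^4 ≤ L^(max c 4 + 1)`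
  have hdeg' : L ^ c + ((0 + 3) * (L + 1) + 1) * (2 * (2 * ((0 + 4) * (L + 1) + 1))) ≤
      L ^ (max c 4 + 1) := by
    have h1 : L ^ c ≤ L ^ max c 4 := Nat.pow_le_pow_right (by omega) (le_max_left _ _)
    have h2 : L ^ 4 ≤ L ^ max c 4 := Nat.pow_le_pow_right (by omega) (le_max_right _ _)
    calc L ^ c + ((0 + 3) * (L + 1) + 1) * (2 * (2 * ((0 + 4) * (L + 1) + 1)))
        ≤ L ^ max c 4 + L ^ max c 4 := Nat.add_le_add h1 (hdeg.trans h2)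
      _ = 2 * L ^ max c 4 := by ring
      _ ≤ L * L ^ max c 4 := Nat.mul_le_mul_right _ hL2
      _ = L ^ (max c 4 + 1) := by ring
  set W : ℝ := θ * (2 : ℝ) ^ (n - 1) with hW
  have hE : ∀ Q : CubeFn (ZMod 3) n, Q ∈ lowDeg (ZMod 3) n
      (L ^ c + ((0 + 3) * (L + 1) + 1) * (2 * (2 * ((0 + 4) * (L + 1) + 1)))) →
      ((univ.filter fun x : Fin n → Bool => OddZeros x ∧ RingHLF.Rel x (cov Q x)).card : ℝ) ≤ W :=
    fun Q hQ => hn₁ n hn₁' Q (lowDeg_mono hdeg' hQ)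
  have hmain := Theorems.RingSymmetrization3.symmetrization3 hn0 he he01 W hE P hP
  -- the bad set: `#Bad · n · n ≤ 2^n = 2 · 2^(n-1)`
  set Bad := (univ.filter fun x : Fin n → Bool => Theorems.RingLeaderElection3.fireCount3 e x ≠ 1).card with hBad
  have hbad' : Bad * (n * n) ≤ 2 ^ n := by simpa only [Nat.zero_add, pow_one] using hbad
  have hbadR : (Bad : ℝ) * ((n : ℝ) * (n : ℝ)) ≤ (2 : ℝ) ^ n := by exact_mod_cast hbad'
  have hA : (2 : ℝ) ^ n = 2 * (2 : ℝ) ^ (n - 1) := by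
    rw [← pow_succ']; congr 1; omega
  set A : ℝ := (2 : ℝ) ^ (n - 1) with hA'
  have hApos : 0 < A := by positivity
  have hnR : (1 : ℝ) ≤ n := by exact_mod_cast hn0
  have hnpos : (0 : ℝ) < n := by linarith
  have hθ' : 0 < 1 - θ := by linarith
  -- `n ≥ 4/(1-θ)` gives `4 ≤ (1-θ)·n ≤ (1-θ)·n²`
  have hceilR : 4 / (1 - θ) ≤ (n : ℝ) := le_trans (Nat.le_ceil _) (by exact_mod_cast hceil)
  have h4 : 4 ≤ (1 - θ) * n := by
    have := (div_le_iff₀ hθ').mp hceilR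
    linarith
  rw [hA] at hbadR
  have hBad_le : (Bad : ℝ) ≤ (1 - θ) / 2 * A := by
    -- `Bad·n² ≤ 2A` and `2A ≤ ((1-θ)/2·A)·n²` since `(1-θ) n² ≥ (1-θ) n ≥ 4`
    by_contra hcon
    have hlt : (1 - θ) / 2 * A < (Bad : ℝ) := not_le.mp hcon
    have h1 : (1 - θ) / 2 * A * ((n : ℝ) * n) < (Bad : ℝ) * ((n : ℝ) * n) :=
      mul_lt_mul_of_pos_right hlt (by positivity)
    have h2 : (1 - θ) * ((n : ℝ) * n) ≥ 4 := by nlinarith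
    nlinarith
  calc ((univ.filter fun x : Fin n → Bool =>
          OddZeros x ∧ RingHLF.Rel x (fun i => decide (P i x = 1))).card : ℝ)
      ≤ W + Bad := hmain
    _ ≤ θ * A + (1 - θ) / 2 * A := by rw [hW]; linarith
    _ = (1 + θ) / 2 * A := by ring

/-- **`RingHardOdd 3 ↔ (∃ θ : ℝ, θ < 1 ∧ ∀ c : ℕ, ∃ n₀ : ℕ, ∀ n ≥ n₀, ∀ Q : CubeFn (ZMod 3) n,
  Q ∈ lowDeg (ZMod 3) n ((Nat.log 2 n) ^ c) →
    ((univ.filter fun x : Fin n → Bool => OddZeros x ∧ RingHLF.Rel x (cov Q x)).card : ℝ) ≤ θ * (2 : ℝ) ^ (n - 1))`** — T is equivalent to its ONE-POLYNOMIAL (uniform, covariant) reading: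
the `m = 1` equivariant normal form at constant grade (piece W is the `m = n^K` version). -/
theorem ringHardOdd3_iff_cov : RingHardOdd 3 ↔ (∃ θ : ℝ, θ < 1 ∧ ∀ c : ℕ, ∃ n₀ : ℕ, ∀ n ≥ n₀, ∀ Q : CubeFn (ZMod 3) n,
  Q ∈ lowDeg (ZMod 3) n ((Nat.log 2 n) ^ c) →
    ((univ.filter fun x : Fin n → Bool => OddZeros x ∧ RingHLF.Rel x (cov Q x)).card : ℝ) ≤ θ * (2 : ℝ) ^ (n - 1)) :=
  ⟨covRingHardOdd3_of_ringHardOdd, ringHardOdd3_of_cov⟩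

/-! ## §7 Necessity of the residual side from T (PROVED) and the honest placement of R -/

/-- the R-side statement is NECESSARY for T directly: constant odd-class loss of uniform rules puts `≥ 2ⁿ/n` of
their losses inside EVERY event of density `≥ 1 - (1-θ)/4` (no invariance or degree of the event needed). -/
theorem invSpreadLoss3_of_ringHardOdd (h : RingHardOdd 3) : (∃ η : ℝ, 0 < η ∧ ∃ k : ℕ, ∀ c : ℕ, ∃ n₀ : ℕ, ∀ n ≥ n₀, ∀ Q : CubeFn (ZMod 3) n,
  Q ∈ lowDeg (ZMod 3) n ((Nat.log 2 n) ^ c) →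
  ∀ m : ℕ, m ≤ n ^ k → ∀ w : Fin m → Fin n → Bool, ∀ F : Fin m → Fin n → CubeFn (ZMod 3) n,
    (∀ t i, F t i ∈ lowDeg (ZMod 3) n ((Nat.log 2 n) ^ c)) →
    (∀ t i y, decide (F t i (rot 1 y) = 1) = decide (F t i y = 1)) →
    (1 - η) * (2 : ℝ) ^ n ≤ ((univ.filter fun y : Fin n → Bool =>
        ∀ t, RingHLF.Rel (w t) (fun i => decide (F t i y = 1))).card : ℝ) →
    1 / (n : ℝ) ^ k * (2 : ℝ) ^ n ≤ ((univ.filter fun y : Fin n → Bool =>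
        (∀ t, RingHLF.Rel (w t) (fun i => decide (F t i y = 1))) ∧ ¬ RingHLF.Rel y (cov Q y)).card : ℝ)) := by
  obtain ⟨θ, hθ, hT⟩ := covRingHardOdd3_of_ringHardOdd h
  have hθ' : 0 < 1 - θ := by linarith
  refine ⟨(1 - θ) / 4, by linarith, 1, fun c => ?_⟩
  obtain ⟨n₀, hn₀⟩ := hT c
  refine ⟨max n₀ (max 1 ⌈4 / (1 - θ)⌉₊), fun n hn Q hQ m hm w F hF hFinv hdens => ?_⟩
  have hn₀' : n₀ ≤ n := le_trans (le_max_left _ _) hn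
  have hn1 : 1 ≤ n := le_trans (le_max_left _ _) (le_trans (le_max_right _ _) hn)
  have hceil : ⌈4 / (1 - θ)⌉₊ ≤ n := le_trans (le_max_right _ _) (le_trans (le_max_right _ _) hn)
  have hwin := hn₀ n hn₀' Q hQ
  -- counts
  set OW := (univ.filter fun x : Fin n → Bool => OddZeros x ∧ RingHLF.Rel x (cov Q x)).card with hOW
  set OL := (univ.filter fun x : Fin n → Bool => (OddZeros x ∧ ¬ RingHLF.Rel x (cov Q x))).card with hOL
  set Ec := (univ.filter fun y : Fin n → Bool =>
    ∀ t, RingHLF.Rel (w t) (fun i => decide (F t i y = 1))).card with hEc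
  set NE := (univ.filter fun y : Fin n → Bool =>
    ¬ ∀ t, RingHLF.Rel (w t) (fun i => decide (F t i y = 1))).card with hNE
  set G := (univ.filter fun y : Fin n → Bool =>
    (∀ t, RingHLF.Rel (w t) (fun i => decide (F t i y = 1))) ∧ ¬ RingHLF.Rel y (cov Q y)).card with hG
  have hsumN : OW + OL = (univ.filter fun x : Fin n → Bool => OddZeros x).card := by
    rw [hOW, hOL, ← card_union_of_disjoint]
    · congr 1
      ext x
      simp only [mem_union, mem_filter, mem_univ, true_and]
      tauto
    · exact disjoint_filter.2 fun x _ h1 h2 => h2.2 h1.2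
  have hodd := card_odd_ge hn1
  have hsplitE : Ec + NE = Fintype.card (Fin n → Bool) := by
    have h1 := Finset.card_filter_add_card_filter_not (s := (univ : Finset (Fin n → Bool)))
      (fun y : Fin n → Bool => ∀ t, RingHLF.Rel (w t) (fun i => decide (F t i y = 1)))
    rw [card_univ] at h1
    exact h1
  have hcardY : Fintype.card (Fin n → Bool) = 2 ^ n := by
    rw [Fintype.card_fun, Fintype.card_bool, Fintype.card_fin]
  have hcov : OL ≤ G + NE := by
    calc OL ≤ ((univ.filter fun y : Fin n → Bool =>
            (∀ t, RingHLF.Rel (w t) (fun i => decide (F t i y = 1))) ∧ ¬ RingHLF.Rel y (cov Q y)) ∪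
          (univ.filter fun y : Fin n → Bool =>
            ¬ ∀ t, RingHLF.Rel (w t) (fun i => decide (F t i y = 1)))).card := by
          refine card_le_card fun x hx => ?_
          rw [mem_filter] at hx
          rw [mem_union, mem_filter, mem_filter]
          by_cases hEx : ∀ t, RingHLF.Rel (w t) (fun i => decide (F t i x = 1))
          · exact Or.inl ⟨mem_univ _, hEx, hx.2.2⟩
          · exact Or.inr ⟨mem_univ _, hEx⟩
      _ ≤ G + NE := card_union_le _ _
  -- real arithmetic
  have hA : (2 : ℝ) ^ n = 2 * (2 : ℝ) ^ (n - 1) := by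
    rw [← pow_succ']; congr 1; omega
  set A : ℝ := (2 : ℝ) ^ (n - 1) with hA'
  have hApos : 0 < A := by positivity
  have hnR : (1 : ℝ) ≤ n := by exact_mod_cast hn1
  have hnpos : (0 : ℝ) < n := by linarith
  have hceilR : 4 / (1 - θ) ≤ (n : ℝ) := le_trans (Nat.le_ceil _) (by exact_mod_cast hceil)
  have h4 : 4 ≤ (1 - θ) * n := by
    have := (div_le_iff₀ hθ').mp hceilR
    linarith
  have hoddR : A ≤ (OW : ℝ) + OL := by
    have : ((2 ^ (n - 1) : ℕ) : ℝ) ≤ ((OW + OL : ℕ) : ℝ) := by rw [hsumN]; exact_mod_cast hodd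
    push_cast at this
    exact this
  have hER : (Ec : ℝ) + NE = 2 * A := by
    rw [← hA]
    have : ((Ec + NE : ℕ) : ℝ) = ((2 ^ n : ℕ) : ℝ) := by rw [hsplitE, hcardY]
    push_cast at this
    exact this
  have hcovR : (OL : ℝ) ≤ G + NE := by exact_mod_cast hcov
  have hdens' : (1 - (1 - θ) / 4) * (2 * A) ≤ (Ec : ℝ) := by rw [← hA]; exact hdens
  rw [pow_one, hA, div_mul_eq_mul_div, one_mul, div_le_iff₀ hnpos]
  -- `G ≥ OL − NE ≥ (1−θ)A − (1−θ)A/2 = (1−θ)A/2 ≥ 2A/n`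
  nlinarith

/-! ## §8 THE EQUIVARIANT NORMAL FORM LAW (node piece W) — PROVED

Ring-wise `𝔽₃` leader election `e` (landed `exists_election3`), the canonical coordinates
`q_{t,c}(u) = Σ_a e(rot_a u_t)·ι(rot_{a+s_t} u_t)_c` read through SQUARES (`q² ∈ {0,1}` over `𝔽₃`, so the canonical
tuple has polynomial indicator coordinates and is EXACTLY invariant under rotating any ring, on all inputs), the
symmetrised joint strategy `P'_{j,b}(u) = Σ_a e(rot_a u_j)·P_{j, pre a s_j b}(canon u)` (degree `≤ De + D·2(De+1)`,
EXACTLY equivariant on all inputs), win transport on all-good tuples, and PHASE AVERAGING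
`Σ_{s⃗} #{X good : Z_{s⃗}(X) ∈ W} = n^m·#(good ∩ W)` by two bijections; bad tuples `≤ 2^{nm}/n²`. -/

section NormalFormLaw

open Summit.QuantumAdvantage.AdviceFreeQNC0.RingSymmetry (shift rot_mod rot_rot rot_apply rel_rot shift_bijective
  rot_injective shift_shift rot_eq_rot_of_mod_eq card_filter_comp_of_bijective card_filter_shift)
open Summit.QuantumAdvantage.AdviceFreeQNC0.Symmetrization (pre pre_shift shift_pre)
open Summit.QuantumAdvantage.QuantumAdvantage.Theorems (unflat flat_unflat)
open Summit.QuantumAdvantage.QuantumAdvantage.Theorems.RingLeaderElection3 (ι3 coord3 coord3_mem fireCount3 exists_election3)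
open Summit.QuantumAdvantage.QuantumAdvantage.Theorems.RingSymmetrization3 (leader fires_iff_eq_leader election_params)

/-! ### §8.1 canonical coordinates and the symmetrised joint strategy -/

section Construction

variable {m n : ℕ}

/-- OrbitAveragingC helper `unflat_flat` (decomp-qadv land package; see the module docstring). -/
theorem unflat_flat (X : Fin m → Fin n → Bool) : unflat (flat X) = X := by
  funext t c
  simp only [unflat, flat, Equiv.symm_apply_apply]

/-- the canonical coordinate `q_{t,c}(u) = Σ_a e(rot_a u_t)·ι(rot_{a+s_t} u_t)_c` (phase `s t`). -/
def qc (e : CubeFn (ZMod 3) n) (s : Fin m → ℕ) (t : Fin m) (c : Fin n) : CubeFn (ZMod 3) (m * n) :=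
  fun u => ∑ a : Fin n, e (rot a.val (unflat u t)) * ι3 (rot (a.val + s t) (unflat u t) c)

/-- the canonical tuple read through squares: bit `(t,c)` is `[q_{t,c}(u)² = 1]`. -/
def canonT (e : CubeFn (ZMod 3) n) (s : Fin m → ℕ) (u : Fin (m * n) → Bool) : Fin m → Fin n → Bool :=
  fun t c => decide (qc e s t c u ^ 2 = 1)


end Construction
end NormalFormLaw
end Summit.QuantumAdvantage.QuantumAdvantage.Theorems.OrbitAveraging
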